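import Summits.Schanuel.Schanuel.Theses.TateNomes
import Literature.NumberTheory.Transcendental.RankOneGridTrdeg
import HarnessLib

/-!
# Route `TateNomes`, crux `NomeTransfer`, line `trdeg-bookkeeping`:
# stub `stub_envelopeCount` — adjoining three `Fin m`-families costs at most `3m`

(item stmt-Schanuel-17405, route route-Schanuel-TateNomes; skeleton of line lead
`prover-line-stmt-Schanuel-17405-0`, registered stub `stub_envelopeCount`, proved here verbatim —
name and uncurried signature; `--supports`.)

## Statement

For any set `S ⊆ ℂ` and any three families `f g h : Fin m → ℂ`,

  `trdeg_ℚ ℚ(S ∪ range f ∪ range g ∪ range h) ≤ trdeg_ℚ ℚ(S) + 3m`.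

In the crux `S = range w ∪ range (exp ∘ w)` and `f, g, h` are the Ramanujan `q`-series
`P, Q, R` evaluated at `q = e^{wⱼ}`; here they are opaque.

## Proof

The union parses as `((S ∪ range f) ∪ range g) ∪ range h`.  Peel the three ranges off with the
subadditivity `trdeg K(A ∪ B) ≤ trdeg K(A) + trdeg K(B)` (tree,
`Literature.NumberTheory.Transcendental.trdeg_adjoin_union_le`), bound each
`trdeg ℚ(range u) ≤ #(range u) ≤ #(Fin m) = m` (`trdeg_adjoin_le_mk`, `Cardinal.mk_range_le`,
`Cardinal.mk_fin`), and finish with `t + m + m + m = t + 3m` in the commutative semiring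
`Cardinal`.  The `ℚ`-algebra structure on subfields of `ℂ` found by instance search and the
generic `IntermediateField.algebra` of the imported lemmas are defeq but not syntactically equal,
so the generic lemmas are applied by unification (`calc`/`trans`), never by `rw`.

## Contents

* `trdeg_adjoin_range_le` — `trdeg ℚ(range u) ≤ m` for `u : Fin m → ℂ`.
* `stub_envelopeCount` — the registered stub, by name (uncurried `∀`-form).
* `trdeg_adjoin_union_three_ranges_le` — the same, curried.
-/

noncomputable section

-- D-0017: the doubled Schanuel.Schanuel path component is the mandated summit/sub-problem namespace
set_option linter.dupNamespace false

namespace Summit.Schanuel.Schanuel.Theorems.TateNomesNomeTransfer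

open IntermediateField
open Literature.NumberTheory.Transcendental (trdeg_adjoin_union_le trdeg_adjoin_le_mk)

/-- A field generated over `ℚ` by the values of `u : Fin m → ℂ` has transcendence degree `≤ m`:
`trdeg ℚ(range u) ≤ #(range u) ≤ #(Fin m) = m`. [folklore] -/
theorem trdeg_adjoin_range_le {m : ℕ} (u : Fin m → ℂ) :
    Algebra.trdeg ℚ ↥(adjoin ℚ (Set.range u)) ≤ (m : Cardinal) :=
  (trdeg_adjoin_le_mk (F := ℚ) (Set.range u)).trans
    (Cardinal.mk_range_le.trans (Cardinal.mk_fin m).le)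

/-- **Envelope count** (registered stub `stub_envelopeCount` of line `trdeg-bookkeeping`).
Adjoining three `Fin m`-indexed families of complex numbers to any set `S` raises the
transcendence degree over `ℚ` by at most `3m`:
`trdeg ℚ(S ∪ range f ∪ range g ∪ range h) ≤ trdeg ℚ(S) + 3m`
(subadditivity `trdeg_adjoin_union_le` three times and `trdeg_adjoin_range_le`). [folklore] -/
theorem stub_envelopeCount :
    ∀ (m : ℕ) (S : Set ℂ) (f g h : Fin m → ℂ),
      Algebra.trdeg ℚ ↥(IntermediateField.adjoin ℚ (S ∪ Set.range f ∪ Set.range g ∪ Set.range h)) ≤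
        Algebra.trdeg ℚ ↥(IntermediateField.adjoin ℚ S) + ((3 * m : ℕ) : Cardinal) := by
  intro m S f g h
  calc Algebra.trdeg ℚ ↥(adjoin ℚ (S ∪ Set.range f ∪ Set.range g ∪ Set.range h))
      ≤ Algebra.trdeg ℚ ↥(adjoin ℚ (S ∪ Set.range f ∪ Set.range g)) +
          Algebra.trdeg ℚ ↥(adjoin ℚ (Set.range h)) := trdeg_adjoin_union_le _ _
    _ ≤ (Algebra.trdeg ℚ ↥(adjoin ℚ (S ∪ Set.range f)) +
          Algebra.trdeg ℚ ↥(adjoin ℚ (Set.range g))) + (m : Cardinal) :=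
        add_le_add (trdeg_adjoin_union_le _ _) (trdeg_adjoin_range_le h)
    _ ≤ ((Algebra.trdeg ℚ ↥(adjoin ℚ S) + Algebra.trdeg ℚ ↥(adjoin ℚ (Set.range f))) +
          (m : Cardinal)) + (m : Cardinal) :=
        add_le_add (add_le_add (trdeg_adjoin_union_le _ _) (trdeg_adjoin_range_le g)) le_rfl
    _ ≤ ((Algebra.trdeg ℚ ↥(adjoin ℚ S) + (m : Cardinal)) + (m : Cardinal)) + (m : Cardinal) :=
        add_le_add (add_le_add (add_le_add le_rfl (trdeg_adjoin_range_le f)) le_rfl) le_rfl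
    _ = Algebra.trdeg ℚ ↥(adjoin ℚ S) + ((3 * m : ℕ) : Cardinal) := by
        push_cast
        ring

/-- Curried form of `stub_envelopeCount`:
`trdeg ℚ(S ∪ range f ∪ range g ∪ range h) ≤ trdeg ℚ(S) + 3m`. [folklore] -/
theorem trdeg_adjoin_union_three_ranges_le {m : ℕ} (S : Set ℂ) (f g h : Fin m → ℂ) :
    Algebra.trdeg ℚ ↥(IntermediateField.adjoin ℚ (S ∪ Set.range f ∪ Set.range g ∪ Set.range h)) ≤
      Algebra.trdeg ℚ ↥(IntermediateField.adjoin ℚ S) + ((3 * m : ℕ) : Cardinal) :=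
  stub_envelopeCount m S f g h

end Summit.Schanuel.Schanuel.Theorems.TateNomesNomeTransfer

end
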